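import Summits.ABC.IUTFork.Cor312StepXIabcReal
import Summits.ABC.IUTFork.Thm311ToCor312
import HarnessLib

/-!
# [IUTchIII] Cor. 3.12, Step (xi-a): the gluing reading instantiated at c312-1's `PilotLink`
# (TEAM A, A-2 coda)

Record-only file (D-0012) of the abc-iut cell (Cor. 3.12 strategy TEAM A «direct III§3», seat
abc-iut-c312-10 = A2); TAKES NO SIDE; proof-only. `Cor312StepXIabcReal.lean` (A-2, p411416) proved
`Step.xi_a.Holds` for any reading whose `Obs.valueGroupMapsPilots` content is an abstract parameter
`VG`, with the docstring naming c312-1's object-level `PilotLink` as the intended instantiation; that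
file landed before `Thm311ToCor312.lean` (c312-1, p411317) had an olean, so the instantiation could not
be stated there. This file pins it in the kernel, as promised on the team board (23:02Z/23:12Z lines):

* `stepXIa_holds_pilotLink` — Step (xi-a) (p. 181 l. 33–44) holds under any reading wired to
  `StepXI.LinkAsGluing P D (Thm311ToCor312.PilotLink P)`: the value-group correspondence clause IS
  c312-1's `PilotLink P` ("∃ an identification of objects carrying the Θ-pilot to the q-pilot",
  [IUTchIII] Rmk. 3.8.1), and the gluing-existence clause is the strip-isomorphism nonemptiness
  (Def. 3.8 (ii)'s presupposition; real-instance discharge = L6-t2's strip-category lemmas).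

Pure specialization of the landed `Cor312Proof.stepXIa_holds` — no new definition, no new reading, no
new claim. [claim: Mochizuki2012, status: disputed] Deliberately NOT here: any assertion that
`PilotLink` (or the nonemptiness) HOLDS for an instantiated setting (c312-1's `Checks.independence`
witnesses that the typed premises do not decide the Statement either way); any judgement.
-/

noncomputable section

namespace Summit.ABC

namespace IUTFork

namespace Cor312Proof

open Thm311 Literature.IUT.LogThetaLattice

variable {T : ThetaIndex} {S : Situation T} (P : Cor312.Setting S)

/-- **Step (xi-a) with the value-group clause instantiated at c312-1's `PilotLink`** (the A-2 reading's
intended instantiation, now kernel-pinned): if the reading's `valueGroupMapsPilots` observation yields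
`PilotLink P`, the strips are abstractly isomorphic at every lattice position, and the reading grants
`linkAsGluing` on `LinkAsGluing P D (PilotLink P)`, then the node holds.
[claim: Mochizuki2012, status: disputed] -/
theorem stepXIa_holds_pilotLink (D : ThetaLinkStrips P.LogLink P.Strip)
    {L : Locus → Prop} {O : Obs → Prop}
    (hVG : O .valueGroupMapsPilots → Thm311ToCor312.PilotLink P)
    (hNE : ∀ n m : ℤ, Nonempty (P.IsoS (D.stripLGP (P.lattice.logLink n (m - 1)))
      (D.stripDelta (P.lattice.theater (n + 1) m))))
    (hO : StepXI.LinkAsGluing P D (Thm311ToCor312.PilotLink P) → O .linkAsGluing) :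
    Step.xi_a.Holds L O :=
  stepXIa_holds P D hVG hNE hO

end Cor312Proof

end IUTFork

end Summit.ABC

end
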